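import Summits.KontsevichZagierPeriods.KontsevichZagierPeriods.Theorems.RootDecompRelativeModAbsoluteCylLogSplitP48

/-! # `RootDecompRelativeModAbsoluteCylLogSplitP49` — part 24/27 of the mechanical ≤400-line split of `RungClosure.lean` (sha256 f909f334226f0fb5…)
Source: decomp-kz lens-3 g12 `RungClosure.lean` v9 (HOME/decomp-kz-lens-3/g12/, sha256 f909f334…; critic g4-52/g4-57/g5 CLEARED, «lander: split v9 --supports 30572»): BLOCK I (57 g11 monolith decls missing from P01–P25), BLOCK II/III (WildCertAssembly parts 1–6, 8–10: `Leaf.cellLocalWildCert`, `Leaf.cylKernelZeroLog_of_trees`), Parts 12–13 (`Leaf.regKernelPairDegOne_iff_circlePos_of_trees`), BLOCK G13 (Möbius engine, test §C decided).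
Split by census-1 g9 `gen/splitlean.py`: scopes re-opened with their `open`/`variable`/`set_option` context; mathematics and declaration order unchanged. -/

noncomputable section
open MeasureTheory Set
open Literature.NumberTheory.Transcendental Literature.ModelTheory.ExponentialFields
namespace Summit.KontsevichZagierPeriods.RootDecompRelativeModAbsolute.Rung30571.RegularisedLogLayer.CylLog.Leaf.G13
section FibreMapVariant
open MvPolynomial

/-- `w = snoc (init w) 0 + w_last • e_last` (copy of the private Literature helper). -/
private theorem eq_snoc_init_zero_add' (m : ℕ) (w : Fin (m + 1) → ℝ) :
    w = Fin.snoc (Fin.init w) (0 : ℝ) + w (Fin.last m) • (Pi.single (Fin.last m) (1 : ℝ) : Fin (m + 1) → ℝ) := by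
  ext i
  refine Fin.lastCases ?_ (fun j => ?_) i
  · simp
  · simp [(Fin.castSucc_lt_last j).ne, Fin.init]

/-- Auxiliary step `of_sub_of_mem_relations_of_fibreMap'`: of sub of mem relations of fibre Map'. [bookkeeping] -/
theorem of_sub_of_mem_relations_of_fibreMap' {m : ℕ} {G : Set (Fin m → ℝ)}
    {a b a' b' : (Fin m → ℝ) → ℝ} (ψ ψs : (Fin (m + 1) → ℝ) → ℝ)
    (r r' : KZ.IntegralRep (m + 1)) (hr : r.domain = KZlog.band G a b)
    (hr' : r'.domain = KZlog.band G a' b') (hab : ∀ y ∈ G, a y ≤ b y)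
    (hψ : IsSemialgebraicFunOn ℚ r.domain ψ)
    (hψd : ∀ z ∈ r.domain, DifferentiableAt ℝ ψ z)
    (hψs : ∀ z ∈ r.domain,
      HasDerivAt (fun t : ℝ => ψ (Fin.snoc (Fin.init z) t)) (ψs z) (z (Fin.last m)))
    (hpos : ∀ z ∈ r.domain, a (Fin.init z) < z (Fin.last m) → z (Fin.last m) < b (Fin.init z) → 0 < ψs z)
    (hnn : ∀ z ∈ r.domain, 0 ≤ ψs z)
    (ha : ∀ y ∈ G, ψ (Fin.snoc y (a y)) = a' y) (hb : ∀ y ∈ G, ψ (Fin.snoc y (b y)) = b' y)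
    (hint : ∀ z ∈ r.domain, r.integrand z = r'.integrand (Fin.snoc (Fin.init z) (ψ z)) * ψs z) :
    KZ.of r - KZ.of r' ∈ KZ.relations := by
  have hmemG : ∀ z ∈ r.domain, Fin.init z ∈ G := fun z hz => by
    rw [hr] at hz
    exact hz.1
  have hsnoc_mem : ∀ y ∈ G, ∀ t ∈ Icc (a y) (b y), (Fin.snoc y t : Fin (m + 1) → ℝ) ∈ r.domain := by
    intro y hy t ht
    rw [hr, KZlog.snoc_mem_band]
    exact ⟨hy, ht⟩
  -- the fibre maps
  have hfib_deriv : ∀ y ∈ G, ∀ t ∈ Icc (a y) (b y),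
      HasDerivAt (fun s : ℝ => ψ (Fin.snoc y s)) (ψs (Fin.snoc y t)) t := by
    intro y hy t ht
    have h := hψs _ (hsnoc_mem y hy t ht)
    simpa only [Fin.init_snoc, Fin.snoc_last] using h
  have hfib_cont : ∀ y ∈ G, ContinuousOn (fun s : ℝ => ψ (Fin.snoc y s)) (Icc (a y) (b y)) :=
    fun y hy t ht => (hfib_deriv y hy t ht).continuousAt.continuousWithinAt
  have hfib_mono : ∀ y ∈ G, StrictMonoOn (fun s : ℝ => ψ (Fin.snoc y s)) (Icc (a y) (b y)) := by
    intro y hy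
    refine strictMonoOn_of_deriv_pos (convex_Icc _ _) (hfib_cont y hy) fun t ht => ?_
    rw [interior_Icc] at ht
    have hd := hfib_deriv y hy t (Ioo_subset_Icc_self ht)
    rw [hd.deriv]
    exact hpos _ (hsnoc_mem y hy t (Ioo_subset_Icc_self ht)) (by simpa only [Fin.init_snoc, Fin.snoc_last] using ht.1)
      (by simpa only [Fin.init_snoc, Fin.snoc_last] using ht.2)
  -- the substitution
  set Φ : (Fin (m + 1) → ℝ) → (Fin (m + 1) → ℝ) := fun z => Fin.snoc (Fin.init z) (ψ z) with hΦ
  let Φ' : (Fin (m + 1) → ℝ) → (Fin (m + 1) → ℝ) →L[ℝ] (Fin (m + 1) → ℝ) := fun z =>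
    ContinuousLinearMap.pi
      (Fin.lastCases (motive := fun _ => (Fin (m + 1) → ℝ) →L[ℝ] ℝ) (fderiv ℝ ψ z)
        (fun i => ContinuousLinearMap.proj (Fin.castSucc i)))
  have hΦ' : ∀ z w, Φ' z w = Fin.snoc (Fin.init w) (fderiv ℝ ψ z w) := by
    intro z w
    funext i
    refine Fin.lastCases ?_ (fun j => ?_) i
    · simp [Φ']
    · simp [Φ', Fin.init]
  -- the partial derivative along the last coordinate is `ψs`
  have hlast : ∀ z ∈ r.domain, fderiv ℝ ψ z (Pi.single (Fin.last m) 1) = ψs z := by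
    intro z hz
    have hγ : HasDerivAt (fun t : ℝ => (Fin.snoc (Fin.init z) t : Fin (m + 1) → ℝ))
        (Pi.single (Fin.last m) (1 : ℝ)) (z (Fin.last m)) := by
      rw [hasDerivAt_pi]
      intro i
      refine Fin.lastCases ?_ (fun j => ?_) i
      · simpa using hasDerivAt_id' (z (Fin.last m))
      · simpa [(Fin.castSucc_lt_last j).ne, Fin.init] using hasDerivAt_const (z (Fin.last m)) (z (Fin.castSucc j))
    have h1 : HasDerivAt (fun t : ℝ => ψ (Fin.snoc (Fin.init z) t))
        (fderiv ℝ ψ z (Pi.single (Fin.last m) 1)) (z (Fin.last m)) := by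
      have hψz : HasFDerivAt ψ (fderiv ℝ ψ z) (Fin.snoc (Fin.init z) (z (Fin.last m))) := by
        rw [Fin.snoc_init_self]
        exact (hψd z hz).hasFDerivAt
      exact hψz.comp_hasDerivAt (z (Fin.last m)) hγ
    exact h1.unique (hψs z hz)
  -- determinant
  have hdet : ∀ z ∈ r.domain, (Φ' z).det = ψs z := by
    intro z hz
    let E : (Fin m → ℝ) →ₗ[ℝ] (Fin (m + 1) → ℝ) :=
      LinearMap.pi (Fin.lastCases (motive := fun _ => (Fin m → ℝ) →ₗ[ℝ] ℝ) 0
        (fun i => LinearMap.proj i))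
    have hE : ∀ y, E y = Fin.snoc y 0 := by
      intro y
      funext i
      refine Fin.lastCases ?_ (fun j => ?_) i
      · simp [E]
      · simp [E]
    have h := LinearMap.det_of_snoc_init (Φ' z : (Fin (m + 1) → ℝ) →ₗ[ℝ] (Fin (m + 1) → ℝ))
      LinearMap.id ((fderiv ℝ ψ z : (Fin (m + 1) → ℝ) →ₗ[ℝ] ℝ).comp E)
      (fderiv ℝ ψ z (Pi.single (Fin.last m) 1)) (fun w => by
        rw [ContinuousLinearMap.coe_coe, hΦ', LinearMap.id_apply, LinearMap.comp_apply,
          ContinuousLinearMap.coe_coe, hE]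
        congr 1
        conv_lhs => rw [eq_snoc_init_zero_add' m w]
        rw [map_add, map_smul, smul_eq_mul, mul_comm])
    rw [LinearMap.det_id, mul_one, hlast z hz] at h
    exact h
  -- derivative
  have hderiv : ∀ z ∈ r.domain, HasFDerivAt Φ (Φ' z) z := by
    intro z hz
    rw [hasFDerivAt_pi']
    intro i
    refine Fin.lastCases ?_ (fun j => ?_) i
    · have hfun : (fun x => Φ x (Fin.last m)) = ψ := by
        funext x
        simp [hΦ]
      show HasFDerivAt (fun x => Φ x (Fin.last m)) _ z
      rw [hfun]
      refine (hψd z hz).hasFDerivAt.congr_fderiv (ContinuousLinearMap.ext fun w => ?_)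
      simp [hΦ']
    · have hfun : (fun x => Φ x (Fin.castSucc j)) = fun x => x (Fin.castSucc j) := by
        funext x
        simp [hΦ, Fin.init]
      show HasFDerivAt (fun x => Φ x (Fin.castSucc j)) _ z
      rw [hfun]
      refine (hasFDerivAt_apply (Fin.castSucc j) z).congr_fderiv
        (ContinuousLinearMap.ext fun w => ?_)
      simp [hΦ', Fin.init]
  refine KZ.changeOfVariablesRel_subset_relations ⟨m + 1, r, r', Φ, Φ', ?_, ?_, ?_, ?_, ?_, rfl⟩
  · -- semialgebraic map
    refine (isSemialgebraicMapOn_iff_forall_holds r.isSemialgebraic_domain).mpr fun i => ?_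
    refine Fin.lastCases ?_ (fun j => ?_) i
    · exact hψ.congr fun z _ => by simp [hΦ]
    · exact (isSemialgebraicFunOn_aeval r.isSemialgebraic_domain
        (MvPolynomial.X (Fin.castSucc j))).congr fun z _ => by simp [hΦ, Fin.init]
  · exact fun z hz => (hderiv z hz).hasFDerivWithinAt
  · -- injective
    intro z₁ hz₁ z₂ hz₂ h
    have hy : Fin.init z₁ = Fin.init z₂ := by
      have := congrArg Fin.init h
      simpa [hΦ] using this
    have hl : ψ z₁ = ψ z₂ := by
      have := congrFun h (Fin.last m)
      simpa [hΦ] using this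
    have hyG : Fin.init z₂ ∈ G := hmemG z₂ hz₂
    have ht₁ : z₁ (Fin.last m) ∈ Icc (a (Fin.init z₂)) (b (Fin.init z₂)) := by
      rw [hr] at hz₁; rw [← hy]; exact hz₁.2
    have ht₂ : z₂ (Fin.last m) ∈ Icc (a (Fin.init z₂)) (b (Fin.init z₂)) := by
      rw [hr] at hz₂; exact hz₂.2
    have hl' : ψ (Fin.snoc (Fin.init z₂) (z₁ (Fin.last m))) = ψ (Fin.snoc (Fin.init z₂) (z₂ (Fin.last m))) := by
      rw [Fin.snoc_init_self]
      conv_lhs => rw [← hy, Fin.snoc_init_self]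
      exact hl
    have hs : z₁ (Fin.last m) = z₂ (Fin.last m) := (hfib_mono _ hyG).injOn ht₁ ht₂ hl'
    rw [← Fin.snoc_init_self z₁, ← Fin.snoc_init_self z₂, hy, hs]
  · -- image
    rw [hr']
    ext w
    simp only [mem_image]
    constructor
    · intro hw
      rw [KZlog.mem_band] at hw
      obtain ⟨hy, hw1, hw2⟩ := hw
      have hab' := hab _ hy
      have hivt := intermediate_value_Icc hab' (hfib_cont _ hy)
      rw [ha _ hy, hb _ hy] at hivt
      obtain ⟨t, ht, hwt⟩ := hivt ⟨hw1, hw2⟩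
      have hwt' : ψ (Fin.snoc (Fin.init w) t) = w (Fin.last m) := hwt
      refine ⟨Fin.snoc (Fin.init w) t, hsnoc_mem _ hy t ht, ?_⟩
      simp only [hΦ, Fin.init_snoc]
      rw [hwt', Fin.snoc_init_self]
    · rintro ⟨z, hz, rfl⟩
      have hy : Fin.init z ∈ G := hmemG z hz
      have ht : z (Fin.last m) ∈ Icc (a (Fin.init z)) (b (Fin.init z)) := by
        rw [hr] at hz; exact hz.2
      have hmono := (hfib_mono _ hy).monotoneOn
      have haz : a (Fin.init z) ∈ Icc (a (Fin.init z)) (b (Fin.init z)) := left_mem_Icc.mpr (hab _ hy)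
      have hbz : b (Fin.init z) ∈ Icc (a (Fin.init z)) (b (Fin.init z)) := right_mem_Icc.mpr (hab _ hy)
      have h1 := hmono haz ht ht.1
      have h2 := hmono ht hbz ht.2
      simp only [ha _ hy, hb _ hy, Fin.snoc_init_self] at h1 h2
      rw [KZlog.mem_band]
      simp only [hΦ, Fin.init_snoc, Fin.snoc_last]
      exact ⟨hy, h1, h2⟩
  · intro z hz
    rw [hint z hz, hdet z hz, abs_of_nonneg (hnn z hz)]

/-- The Literature move is the special case `ψs > 0` everywhere. -/
example {m : ℕ} {G : Set (Fin m → ℝ)} {a b a' b' : (Fin m → ℝ) → ℝ} (ψ ψs : (Fin (m + 1) → ℝ) → ℝ)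
    (r r' : KZ.IntegralRep (m + 1)) (hr : r.domain = KZlog.band G a b)
    (hr' : r'.domain = KZlog.band G a' b') (hab : ∀ y ∈ G, a y ≤ b y)
    (hψ : IsSemialgebraicFunOn ℚ r.domain ψ) (hψd : ∀ z ∈ r.domain, DifferentiableAt ℝ ψ z)
    (hψs : ∀ z ∈ r.domain, HasDerivAt (fun t : ℝ => ψ (Fin.snoc (Fin.init z) t)) (ψs z) (z (Fin.last m)))
    (hpos : ∀ z ∈ r.domain, 0 < ψs z)
    (ha : ∀ y ∈ G, ψ (Fin.snoc y (a y)) = a' y) (hb : ∀ y ∈ G, ψ (Fin.snoc y (b y)) = b' y)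
    (hint : ∀ z ∈ r.domain, r.integrand z = r'.integrand (Fin.snoc (Fin.init z) (ψ z)) * ψs z) :
    KZ.of r - KZ.of r' ∈ KZ.relations :=
  of_sub_of_mem_relations_of_fibreMap' ψ ψs r r' hr hr' hab hψ hψd hψs (fun z hz _ _ => hpos z hz)
    (fun z hz => (hpos z hz).le) ha hb hint

end FibreMapVariant

/-! ## ANGLE ADDITION is three KZ moves (g13 engine, general base dimension)

`arctan u₁ + arctan u₂ = arctan((u₁+u₂)/(1−u₁u₂))` on the pole-free sheet `u₁u₂ < 1` (`u₁, u₂ ≥ 0`), read on unfolded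
arctangent monomials `A_u = [{0 ≤ t ≤ u}, p/(1+t²)]`:  `[A_{u₁}] + [A_{u₂}] − [A_ψ] ∈ KZ.relations`,
`ψ = (u₁+u₂)/(1−u₁u₂)` — ONE Möbius rotation (`k = u₁` carries `[0,u₂]` onto `[u₁, ψ]`), ONE fibre split of `A_ψ` at
`t = u₁`, one bookkeeping congruence.  (The sheet `u₁u₂ > 1` adds the `π`-monomial; not treated here.) -/

/-- Auxiliary step `angle_addition_mem_relations`: angle addition mem relations. [bookkeeping] -/
theorem angle_addition_mem_relations {m : ℕ} {G : Set (Fin m → ℝ)} {u₁ u₂ p : (Fin m → ℝ) → ℝ}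
    (r₁ r₂ r₃ : KZ.IntegralRep (m + 1)) (hG : IsSemialgebraic ℚ G)
    (hu₁ : IsSemialgebraicFunOn ℚ G u₁) (hu₂ : IsSemialgebraicFunOn ℚ G u₂)
    (h0₁ : ∀ y ∈ G, 0 ≤ u₁ y) (h0₂ : ∀ y ∈ G, 0 ≤ u₂ y) (hlt : ∀ y ∈ G, u₁ y * u₂ y < 1)
    (hd : ∀ z ∈ r₂.domain, DifferentiableAt ℝ (fun w : Fin (m + 1) → ℝ => u₁ (Fin.init w)) z)
    (hr₁ : r₁.domain = KZlog.band G (fun _ => 0) u₁) (hr₂ : r₂.domain = KZlog.band G (fun _ => 0) u₂)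
    (hr₃ : r₃.domain = KZlog.band G (fun _ => 0) (fun y => (u₁ y + u₂ y) / (1 - u₁ y * u₂ y)))
    (hi₁ : r₁.integrand = fun z => p (Fin.init z) / (1 + z (Fin.last m) ^ 2))
    (hi₂ : r₂.integrand = fun z => p (Fin.init z) / (1 + z (Fin.last m) ^ 2))
    (hi₃ : r₃.integrand = fun z => p (Fin.init z) / (1 + z (Fin.last m) ^ 2)) :
    KZ.of r₁ + KZ.of r₂ - KZ.of r₃ ∈ KZ.relations := by
  -- the composite edge `ψ = (u₁+u₂)/(1−u₁u₂)` and its elementary inequalities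
  set ψ : (Fin m → ℝ) → ℝ := fun y => (u₁ y + u₂ y) / (1 - u₁ y * u₂ y) with hψ
  have hden : ∀ y ∈ G, 0 < 1 - u₁ y * u₂ y := fun y hy => by linarith [hlt y hy]
  have hψsa : IsSemialgebraicFunOn ℚ G ψ :=
    IsSemialgebraicFunOn.div (IsSemialgebraicFunOn.add_holds hu₁ hu₂)
      ((IsSemialgebraicFunOn.sub_holds (isSemialgebraicFunOn_ratCast hG 1)
        (IsSemialgebraicFunOn.mul_holds hu₁ hu₂)).congr fun _ _ => by simp) fun y hy => (hden y hy).ne'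
  have hu₁ψ : ∀ y ∈ G, u₁ y ≤ ψ y := by
    intro y hy
    have h1 := h0₁ y hy; have h2 := h0₂ y hy; have h3 := hden y hy
    rw [hψ, le_div_iff₀ h3]
    nlinarith [mul_nonneg (mul_nonneg h1 h1) h2]
  have h0sa : IsSemialgebraicFunOn ℚ G (fun _ => (0:ℝ)) := (isSemialgebraicFunOn_ratCast hG 0).congr fun _ _ => by simp
  -- the upper piece `r₄ = r₃ ∣ {u₁ ≤ t ≤ ψ}` and the lower piece `r₁' = r₃ ∣ {0 ≤ t ≤ u₁}`
  have hE₄ : IsSemialgebraic ℚ (KZlog.band G u₁ ψ) := KZlog.isSemialgebraic_band hu₁ hψsa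
  have hE₁ : IsSemialgebraic ℚ (KZlog.band G (fun _ => (0:ℝ)) u₁) := KZlog.isSemialgebraic_band h0sa hu₁
  have hsub₄ : KZlog.band G u₁ ψ ⊆ r₃.domain := fun z hz => by
    rw [hr₃]; exact ⟨hz.1, (h0₁ _ hz.1).trans hz.2.1, hz.2.2⟩
  have hsub₁ : KZlog.band G (fun _ => (0:ℝ)) u₁ ⊆ r₃.domain := fun z hz => by
    rw [hr₃]; exact ⟨hz.1, hz.2.1, hz.2.2.trans (hu₁ψ _ hz.1)⟩
  set r₄ := r₃.restrict _ hE₄ hsub₄ with hr₄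
  set r₁' := r₃.restrict _ hE₁ hsub₁ with hr₁'
  -- (1) the Möbius rotation `k = u₁` carries `r₂ = [0, u₂]` onto `r₄ = [u₁, ψ]`
  have hM : KZ.of r₂ - KZ.of r₄ ∈ KZ.relations := by
    have hr' : r₄.domain = KZlog.band G (fun y => ((fun _ : Fin m → ℝ => (0:ℝ)) y + u₁ y) / (1 - u₁ y * (fun _ : Fin m → ℝ => (0:ℝ)) y))
        (fun y => (u₂ y + u₁ y) / (1 - u₁ y * u₂ y)) := by
      ext z
      show z ∈ KZlog.band G u₁ ψ ↔ _
      simp only [KZlog.mem_band, zero_add, mul_zero, sub_zero, div_one, hψ]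
      constructor
      · rintro ⟨hy, h1, h2⟩; exact ⟨hy, h1, by rw [add_comm]; exact h2⟩
      · rintro ⟨hy, h1, h2⟩; exact ⟨hy, h1, by rw [add_comm] at h2; exact h2⟩
    refine of_sub_of_mem_relations_mobius (p := p) (k := u₁) r₂ r₄ hr₂ hr' h0₂ hu₁ hd ?_ hi₂ ?_
    · intro z hz
      rw [hr₂] at hz
      have h1 := h0₁ _ hz.1; have ht := hz.2.2; have hl := hlt _ hz.1
      nlinarith [mul_le_mul_of_nonneg_left ht h1]
    · rw [hr₄]; show r₃.integrand = _; exact hi₃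
  -- (2) the fibre split of `r₃ = [0, ψ]` at `t = u₁`
  have hS : KZ.of r₃ - KZ.of r₁' - KZ.of r₄ ∈ KZ.relations := by
    refine KZ.domainAddRel_subset_relations ⟨m + 1, r₃, r₁', r₄, ?_, ?_, fun _ _ => rfl, fun _ _ => rfl, rfl⟩
    · rw [hr₃]
      show _ = KZlog.band G (fun _ => (0:ℝ)) u₁ ∪ KZlog.band G u₁ ψ
      ext z
      simp only [KZlog.mem_band, mem_union]
      constructor
      · rintro ⟨hy, h0, hu⟩
        rcases le_total (z (Fin.last m)) (u₁ (Fin.init z)) with h | h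
        · exact Or.inl ⟨hy, h0, h⟩
        · exact Or.inr ⟨hy, h, hu⟩
      · rintro (⟨hy, h0, h1⟩ | ⟨hy, h1, hu⟩)
        · exact ⟨hy, h0, h1.trans (hu₁ψ _ hy)⟩
        · exact ⟨hy, (h0₁ _ hy).trans h1, hu⟩
    · refine measure_mono_null (fun z hz => ?_) (KZ.volume_graph_eq_zero hu₁)
      exact ⟨hz.1.1, le_antisymm hz.1.2.2 hz.2.2.1⟩
  -- (3) `r₁' ≡ r₁`
  have hC : KZ.of r₁' - KZ.of r₁ ∈ KZ.relations :=
    KZ.of_sub_of_mem_relations_of_eqOn (by rw [hr₁]; rfl) fun z _ => by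
      show r₃.integrand z = r₁.integrand z
      rw [hi₁, hi₃]
  have key : KZ.of r₁ + KZ.of r₂ - KZ.of r₃ =
      (KZ.of r₂ - KZ.of r₄) - (KZ.of r₃ - KZ.of r₁' - KZ.of r₄) - (KZ.of r₁' - KZ.of r₁) := by abel
  rw [key]
  exact sub_mem (sub_mem hM hS) hC

/-! ## The RECIPROCAL RELATION is five KZ moves (g13 engine, general base dimension)

`arctan u + arctan u⁻¹ = π/2 = 2·arctan 1` (`u ≥ 1`), read on unfolded arctangent monomials:
`[A_u] + [A_{u⁻¹}] − 2[A_1] ∈ KZ.relations` — two fibre splits (`A_u` at `t = 1`, `A_1` at `t = u⁻¹`), two bookkeeping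
congruences, and ONE Möbius rotation `k = (u−1)/(u+1)` carrying `[u⁻¹, 1]` onto `[1, u]`.  Together with
`angle_addition_mem_relations` (pole-free sheet) this realises angle addition on the pole sheet `u₁u₂ > 1` as well
(`arctan u₁ + arctan u₂ = π − (arctan u₁⁻¹ + arctan u₂⁻¹)`), hence every elementary angle relation. -/

/-- the Möbius parameter of the reciprocal relation -/
def mobK {m : ℕ} (u : (Fin m → ℝ) → ℝ) : (Fin m → ℝ) → ℝ := fun y => (u y - 1) / (u y + 1)

end Summit.KontsevichZagierPeriods.RootDecompRelativeModAbsolute.Rung30571.RegularisedLogLayer.CylLog.Leaf.G13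
end
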